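import Mathlib
import Summits.Ventures.PercRepro2.Defs
import Summits.Ventures.PercRepro2.Harris
import Summits.Ventures.PercRepro2.Independence
import Summits.Ventures.PercRepro2.CoinDefs
import Summits.Ventures.PercRepro2.CoinReverse
import Summits.Ventures.PercRepro2.CoinStarDefs
import Summits.Ventures.PercRepro2.CoinLsmCoreDefs
import Summits.Ventures.PercRepro2.CoinLsmCoreU
import Summits.Ventures.PercRepro2.CoinCoreGate
import Summits.Ventures.PercRepro2.CoinOrTailAlg
import Summits.Ventures.PercRepro2.CoinOrTailDefs
import Summits.Ventures.PercRepro2.CoinOrTailLsmDefs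
import Summits.Ventures.PercRepro2.CoinOrTailLsmSums
import Summits.Ventures.PercRepro2.CoinOrTailBlockAlg
import Summits.Ventures.PercRepro2.CoinOrTailBlockSums
import Summits.Ventures.PercRepro2.CoinOrTailMixLsm
import Summits.Ventures.PercRepro2.CoinBlockTheoremII
import Summits.Ventures.PercRepro2.CoinBlockMeanOrder
import Summits.Ventures.PercRepro2.CoinLsmCoreSure
import Summits.Ventures.PercRepro2.CoinMixBlock
import Summits.Ventures.PercRepro2.CoinOrTailKDefs
import Summits.Ventures.PercRepro2.CoinOrTailKSums
import Summits.Ventures.PercRepro2.CoinOrTailKAlg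
import Summits.Ventures.PercRepro2.CoinOrTailCovCore
import Summits.Ventures.PercRepro2.CoinOrTailKCore
import Summits.Ventures.PercRepro2.CoinOrTailKOneAlg
import Summits.Ventures.PercRepro2.CoinOrTailKChainAlg
import Summits.Ventures.PercRepro2.CoinK2HeadBlindBlock
import Summits.Ventures.PercRepro2.CoinK2HeadBlindVals

/-!
# Row 2′DARC at an OR-tail with ANY entry set when the head is fed only through the tail
(blind cell PercRepro2, night-2 g12; proofs/NIGHT2-DARC.md §47.11)

`OrTailK arcs s U ent c a` with ANY entry set (covered or not, any coins, no condition on the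
markers) under the ENTRY-BLIND hypothesis `P(W ∪ X ↛ t) = P(X ↛ t)` for `X ⊆ {a, w}` («the core's
only exits into the head are `a` and `w`»).  With `α₀ = A ∅`, `α₁ = A {a}`, `α₂ = A {a, w}` and the
tail weight `tw`: `rValK = tw·α₀ + (1 − tw)·α₁`, `gValK = tw·α₀ + (1 − tw)·α₂`, hence
`α₁·F(Λ, M) = α₂·F(Λ, Λ) + α₀(α₁ − α₂)·F(Λ, T)` with `T = Σ ν·tw` the tail-avoiding mass:
`F(Λ, Λ) = Λ·C(Λ) ≥ 0`, and `F(Λ, T) ≥ 0` because `ν·tw` is log-modular (`tailWtK_mul_eq`) and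
Holley-BELOW the `R`-weight (`tw(s ∩ t)·v(s ∪ t) − tw(t)·v(s) = α₁·(tw(s ∩ t) − tw(t)) ≥ 0`).
-/

namespace Summit.Ventures.PercRepro2.Coin

open Classical

section TrivialHead

variable {V : Type*} {E : Type*} [Fintype V] [DecidableEq V] {R : Type*} [Field R] [LinearOrder R]
  [IsStrictOrderedRing R]

/-- **THE ENTRY-BLIND OR-TAIL FUNCTIONAL IS NONNEGATIVE FOR ANY ENTRY SET.** -/
theorem orTailK_trivialHead_functional_nonneg (U : Finset V) (ν A : Finset V → R) (pr : E → R)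
    (ent : Finset V) (c : V → E) (m₁ m₂ a w : V)
    (hp0 : ∀ e, 0 ≤ pr e) (hp1 : ∀ e, pr e ≤ 1)
    (hν0 : ∀ W, 0 ≤ ν W) (hν : ∀ s ⊆ U, ∀ t ⊆ U, ν s * ν t ≤ ν (s ∩ t) * ν (s ∪ t))
    (hA0 : ∀ W, 0 ≤ A W) (hA : ∀ s t : Finset V, A s * A t ≤ A (s ∩ t) * A (s ∪ t))
    (hmono : ∀ s t : Finset V, s ⊆ t → A t ≤ A s)
    (htriv : ∀ W ⊆ U, ∀ X ⊆ ({a, w} : Finset V), A (W ∪ X) = A X) :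
    0 ≤ (∑ W ∈ U.powerset, ν W * rValK A pr ent c a W) ^ 2 *
          (∑ W ∈ U.powerset, ν W * gValK A pr ent c a w W *
            ((if m₁ ∈ W then (1 : R) else 0) * (if m₂ ∈ W then (1 : R) else 0)))
        - (∑ W ∈ U.powerset, ν W * rValK A pr ent c a W) *
          (∑ W ∈ U.powerset, ν W * rValK A pr ent c a W * (if m₁ ∈ W then (1 : R) else 0)) *
          (∑ W ∈ U.powerset, ν W * gValK A pr ent c a w W * (if m₂ ∈ W then (1 : R) else 0))
        - (∑ W ∈ U.powerset, ν W * rValK A pr ent c a W) *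
          (∑ W ∈ U.powerset, ν W * rValK A pr ent c a W * (if m₂ ∈ W then (1 : R) else 0)) *
          (∑ W ∈ U.powerset, ν W * gValK A pr ent c a w W * (if m₁ ∈ W then (1 : R) else 0))
        + (∑ W ∈ U.powerset, ν W * rValK A pr ent c a W * (if m₁ ∈ W then (1 : R) else 0)) *
          (∑ W ∈ U.powerset, ν W * rValK A pr ent c a W * (if m₂ ∈ W then (1 : R) else 0)) *
          (∑ W ∈ U.powerset, ν W * gValK A pr ent c a w W) := by
  have hr0 : ∀ W, 0 ≤ rValK A pr ent c a W := fun W => rValK_nonneg hp0 hp1 hA0 ent c a W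
  have htw0 : ∀ W, 0 ≤ tailWtK pr ent c W := fun W => tailWtK_nonneg hp1 ent c W
  -- the three head values
  set α₀ : R := A ∅ with hα₀def
  set α₁ : R := A {a} with hα₁def
  set α₂ : R := A ({a, w} : Finset V) with hα₂def
  have hα₁0 : 0 ≤ α₁ := hA0 _
  have hα₂0 : 0 ≤ α₂ := hA0 _
  have hα₁₀ : α₁ ≤ α₀ := hmono ∅ {a} (Finset.empty_subset _)
  have hα₂₁ : α₂ ≤ α₁ := hmono {a} {a, w} (Finset.singleton_subset_iff.2 (by simp))
  -- the values on the core
  have hvW : ∀ W ⊆ U, rValK A pr ent c a W = tailWtK pr ent c W * α₀ + (1 - tailWtK pr ent c W) * α₁ := by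
    intro W hW
    unfold rValK
    have e0 : A W = α₀ := by
      have := htriv W hW ∅ (Finset.empty_subset _)
      rwa [Finset.union_empty] at this
    have e1 : A (W ∪ {a}) = α₁ := htriv W hW {a} (Finset.singleton_subset_iff.2 (by simp))
    rw [e0, e1]
  have hgW : ∀ W ⊆ U, gValK A pr ent c a w W = tailWtK pr ent c W * α₀ + (1 - tailWtK pr ent c W) * α₂ := by
    intro W hW
    unfold gValK
    have e0 : A W = α₀ := by
      have := htriv W hW ∅ (Finset.empty_subset _)
      rwa [Finset.union_empty] at this
    have e2 : A (W ∪ {a, w}) = α₂ := htriv W hW {a, w} (subset_refl _)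
    rw [e0, e2]
  -- the pointwise mixture identity
  have hmix : ∀ W ⊆ U, α₁ * (ν W * gValK A pr ent c a w W) =
      α₂ * (ν W * rValK A pr ent c a W) + α₀ * (α₁ - α₂) * (ν W * tailWtK pr ent c W) := by
    intro W hW
    rw [hvW W hW, hgW W hW]; ring
  -- the `R`-weight and the tail-avoiding weight
  set G : Finset V → R := fun W => ν W * rValK A pr ent c a W with hGdef
  set T : Finset V → R := fun W => ν W * tailWtK pr ent c W with hTdef
  have hG0 : ∀ W, 0 ≤ G W := fun W => mul_nonneg (hν0 W) (hr0 W)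
  have hT0 : ∀ W, 0 ≤ T W := fun W => mul_nonneg (hν0 W) (htw0 W)
  have hG : ∀ s' ⊆ U, ∀ t' ⊆ U, G s' * G t' ≤ G (s' ∩ t') * G (s' ∪ t') := by
    intro s' hs' t' ht'
    simp only [hGdef]
    calc ν s' * rValK A pr ent c a s' * (ν t' * rValK A pr ent c a t')
        = (ν s' * ν t') * (rValK A pr ent c a s' * rValK A pr ent c a t') := by ring
      _ ≤ (ν (s' ∩ t') * ν (s' ∪ t')) *
            (rValK A pr ent c a (s' ∩ t') * rValK A pr ent c a (s' ∪ t')) :=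
          mul_le_mul (hν s' hs' t' ht') (rValK_mul_le_all A pr ent c a hp0 hp1 hA0 hA hmono s' t')
            (mul_nonneg (hr0 _) (hr0 _)) (mul_nonneg (hν0 _) (hν0 _))
      _ = ν (s' ∩ t') * rValK A pr ent c a (s' ∩ t') *
            (ν (s' ∪ t') * rValK A pr ent c a (s' ∪ t')) := by ring
  -- `T` is log-supermodular (log-modular tail weight)
  have hT : ∀ s' ⊆ U, ∀ t' ⊆ U, T s' * T t' ≤ T (s' ∩ t') * T (s' ∪ t') := by
    intro s' hs' t' ht'
    simp only [hTdef]
    have h1 := hν s' hs' t' ht'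
    have h2 := tailWtK_mul_eq pr ent c s' t'
    calc ν s' * tailWtK pr ent c s' * (ν t' * tailWtK pr ent c t')
        = (ν s' * ν t') * (tailWtK pr ent c s' * tailWtK pr ent c t') := by ring
      _ ≤ (ν (s' ∩ t') * ν (s' ∪ t')) * (tailWtK pr ent c s' * tailWtK pr ent c t') :=
          mul_le_mul_of_nonneg_right h1 (mul_nonneg (htw0 _) (htw0 _))
      _ = (ν (s' ∩ t') * ν (s' ∪ t')) *
            (tailWtK pr ent c (s' ∩ t') * tailWtK pr ent c (s' ∪ t')) := by rw [h2]
      _ = _ := by ring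
  -- `T` is Holley-BELOW `G`
  have hGT : ∀ s' ⊆ U, ∀ t' ⊆ U, G s' * T t' ≤ T (s' ∩ t') * G (s' ∪ t') := by
    intro s' hs' t' ht'
    simp only [hGdef, hTdef]
    have h1 := hν s' hs' t' ht'
    have hst : s' ∩ t' ⊆ U := fun x hx => hs' (Finset.mem_inter.1 hx).1
    have hsu : s' ∪ t' ⊆ U := Finset.union_subset hs' ht'
    rw [hvW s' hs', hvW (s' ∪ t') hsu]
    have hmul := tailWtK_mul_eq pr ent c s' t'
    have hanti := tailWtK_anti hp0 hp1 ent c (Finset.inter_subset_right : s' ∩ t' ⊆ t')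
    -- the value step: `tw(t)·v(s) ≤ tw(s ∩ t)·v(s ∪ t)`
    have hval : tailWtK pr ent c t' *
        (tailWtK pr ent c s' * α₀ + (1 - tailWtK pr ent c s') * α₁) ≤
        tailWtK pr ent c (s' ∩ t') *
          (tailWtK pr ent c (s' ∪ t') * α₀ + (1 - tailWtK pr ent c (s' ∪ t')) * α₁) := by
      have e : tailWtK pr ent c (s' ∩ t') *
          (tailWtK pr ent c (s' ∪ t') * α₀ + (1 - tailWtK pr ent c (s' ∪ t')) * α₁) -
          tailWtK pr ent c t' * (tailWtK pr ent c s' * α₀ + (1 - tailWtK pr ent c s') * α₁) =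
          α₁ * (tailWtK pr ent c (s' ∩ t') - tailWtK pr ent c t') +
            (α₀ - α₁) * (tailWtK pr ent c (s' ∩ t') * tailWtK pr ent c (s' ∪ t') -
              tailWtK pr ent c s' * tailWtK pr ent c t') := by ring
      have hz : tailWtK pr ent c (s' ∩ t') * tailWtK pr ent c (s' ∪ t') -
          tailWtK pr ent c s' * tailWtK pr ent c t' = 0 := by rw [hmul]; ring
      have hpos : 0 ≤ α₁ * (tailWtK pr ent c (s' ∩ t') - tailWtK pr ent c t') :=
        mul_nonneg hα₁0 (sub_nonneg.2 hanti)
      rw [hz, mul_zero, add_zero] at e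
      linarith
    calc ν s' * (tailWtK pr ent c s' * α₀ + (1 - tailWtK pr ent c s') * α₁) *
          (ν t' * tailWtK pr ent c t')
        = (ν s' * ν t') *
            (tailWtK pr ent c t' * (tailWtK pr ent c s' * α₀ + (1 - tailWtK pr ent c s') * α₁)) := by
          ring
      _ ≤ (ν (s' ∩ t') * ν (s' ∪ t')) *
            (tailWtK pr ent c (s' ∩ t') *
              (tailWtK pr ent c (s' ∪ t') * α₀ + (1 - tailWtK pr ent c (s' ∪ t')) * α₁)) := by
          refine mul_le_mul h1 hval ?_ (mul_nonneg (hν0 _) (hν0 _))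
          refine mul_nonneg (htw0 _) ?_
          have := hvW s' hs'
          rw [← this]; exact hr0 _
      _ = _ := by ring
  -- the two block facts
  have hFT := gateF_nonneg_of_below U G T m₁ m₂ hG0 hT0 hT hGT
  have H1 : (∑ W ∈ U.powerset, G W * cellWt m₁ m₂ true false W) *
      (∑ W ∈ U.powerset, G W * cellWt m₁ m₂ false true W) ≤
      (∑ W ∈ U.powerset, G W * cellWt m₁ m₂ false false W) *
      (∑ W ∈ U.powerset, G W * cellWt m₁ m₂ true true W) := by
    have := cellBlock_mul_le U G G G G m₁ m₂ true false false true hG0 hG0 hG0 hG0 hG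
    simpa only [Bool.true_and, Bool.and_true, Bool.false_or, Bool.or_false] using this
  have hFL : 0 ≤ gateF (∑ W ∈ U.powerset, G W * cellWt m₁ m₂ false false W)
      (∑ W ∈ U.powerset, G W * cellWt m₁ m₂ false true W)
      (∑ W ∈ U.powerset, G W * cellWt m₁ m₂ true false W)
      (∑ W ∈ U.powerset, G W * cellWt m₁ m₂ true true W)
      (∑ W ∈ U.powerset, G W * cellWt m₁ m₂ false false W)
      (∑ W ∈ U.powerset, G W * cellWt m₁ m₂ false true W)
      (∑ W ∈ U.powerset, G W * cellWt m₁ m₂ true false W)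
      (∑ W ∈ U.powerset, G W * cellWt m₁ m₂ true true W) := by
    rw [gateF_self]
    refine mul_nonneg ?_ (sub_nonneg.2 H1)
    have h0 : ∀ b₁ b₂, 0 ≤ ∑ W ∈ U.powerset, G W * cellWt m₁ m₂ b₁ b₂ W := fun b₁ b₂ =>
      Finset.sum_nonneg fun W _ => mul_nonneg (hG0 W) (cellWt_nonneg _ _ _ _ _)
    have := h0 false false; have := h0 false true; have := h0 true false; have := h0 true true
    linarith
  -- the gate block sums as the mixture
  have hM : ∀ b₁ b₂, α₁ * (∑ W ∈ U.powerset, ν W * gValK A pr ent c a w W * cellWt m₁ m₂ b₁ b₂ W) =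
      α₂ * (∑ W ∈ U.powerset, G W * cellWt m₁ m₂ b₁ b₂ W) +
        α₀ * (α₁ - α₂) * (∑ W ∈ U.powerset, T W * cellWt m₁ m₂ b₁ b₂ W) := by
    intro b₁ b₂
    rw [Finset.mul_sum, Finset.mul_sum, Finset.mul_sum, ← Finset.sum_add_distrib]
    refine Finset.sum_congr rfl fun W hW => ?_
    have := hmix W (Finset.mem_powerset.1 hW)
    simp only [hGdef, hTdef]
    calc α₁ * (ν W * gValK A pr ent c a w W * cellWt m₁ m₂ b₁ b₂ W)
        = (α₁ * (ν W * gValK A pr ent c a w W)) * cellWt m₁ m₂ b₁ b₂ W := by ring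
      _ = (α₂ * (ν W * rValK A pr ent c a W) +
            α₀ * (α₁ - α₂) * (ν W * tailWtK pr ent c W)) * cellWt m₁ m₂ b₁ b₂ W := by rw [this]
      _ = _ := by ring
  -- the marker split of the goal
  have eΛ := sum_split_four U (fun W => ν W * rValK A pr ent c a W) m₁ m₂
  have eF1 := sum_split_fst U (fun W => ν W * rValK A pr ent c a W) m₁ m₂
  have eF2 := sum_split_snd U (fun W => ν W * rValK A pr ent c a W) m₁ m₂
  have eM := sum_split_four U (fun W => ν W * gValK A pr ent c a w W) m₁ m₂
  have eX := sum_split_fst U (fun W => ν W * gValK A pr ent c a w W) m₁ m₂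
  have eY := sum_split_snd U (fun W => ν W * gValK A pr ent c a w W) m₁ m₂
  have eXY := sum_split_both U (fun W => ν W * gValK A pr ent c a w W) m₁ m₂
  rw [eΛ, eF1, eF2, eM, eX, eY, eXY]
  -- `α₁ · F(Λ, M) = α₂ · F(Λ, Λ) + α₀(α₁ − α₂) · F(Λ, T)`
  have key : α₁ * gateF (∑ W ∈ U.powerset, G W * cellWt m₁ m₂ false false W)
      (∑ W ∈ U.powerset, G W * cellWt m₁ m₂ false true W)
      (∑ W ∈ U.powerset, G W * cellWt m₁ m₂ true false W)
      (∑ W ∈ U.powerset, G W * cellWt m₁ m₂ true true W)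
      (∑ W ∈ U.powerset, ν W * gValK A pr ent c a w W * cellWt m₁ m₂ false false W)
      (∑ W ∈ U.powerset, ν W * gValK A pr ent c a w W * cellWt m₁ m₂ false true W)
      (∑ W ∈ U.powerset, ν W * gValK A pr ent c a w W * cellWt m₁ m₂ true false W)
      (∑ W ∈ U.powerset, ν W * gValK A pr ent c a w W * cellWt m₁ m₂ true true W) =
      α₂ * gateF (∑ W ∈ U.powerset, G W * cellWt m₁ m₂ false false W)
        (∑ W ∈ U.powerset, G W * cellWt m₁ m₂ false true W)
        (∑ W ∈ U.powerset, G W * cellWt m₁ m₂ true false W)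
        (∑ W ∈ U.powerset, G W * cellWt m₁ m₂ true true W)
        (∑ W ∈ U.powerset, G W * cellWt m₁ m₂ false false W)
        (∑ W ∈ U.powerset, G W * cellWt m₁ m₂ false true W)
        (∑ W ∈ U.powerset, G W * cellWt m₁ m₂ true false W)
        (∑ W ∈ U.powerset, G W * cellWt m₁ m₂ true true W) +
      α₀ * (α₁ - α₂) * gateF (∑ W ∈ U.powerset, G W * cellWt m₁ m₂ false false W)
        (∑ W ∈ U.powerset, G W * cellWt m₁ m₂ false true W)
        (∑ W ∈ U.powerset, G W * cellWt m₁ m₂ true false W)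
        (∑ W ∈ U.powerset, G W * cellWt m₁ m₂ true true W)
        (∑ W ∈ U.powerset, T W * cellWt m₁ m₂ false false W)
        (∑ W ∈ U.powerset, T W * cellWt m₁ m₂ false true W)
        (∑ W ∈ U.powerset, T W * cellWt m₁ m₂ true false W)
        (∑ W ∈ U.powerset, T W * cellWt m₁ m₂ true true W) := by
    rw [← gateF_smul, ← gateF_smul, ← gateF_smul, ← gateF_add, hM, hM, hM, hM]
  have hsum : 0 ≤ α₂ * gateF (∑ W ∈ U.powerset, G W * cellWt m₁ m₂ false false W)
        (∑ W ∈ U.powerset, G W * cellWt m₁ m₂ false true W)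
        (∑ W ∈ U.powerset, G W * cellWt m₁ m₂ true false W)
        (∑ W ∈ U.powerset, G W * cellWt m₁ m₂ true true W)
        (∑ W ∈ U.powerset, G W * cellWt m₁ m₂ false false W)
        (∑ W ∈ U.powerset, G W * cellWt m₁ m₂ false true W)
        (∑ W ∈ U.powerset, G W * cellWt m₁ m₂ true false W)
        (∑ W ∈ U.powerset, G W * cellWt m₁ m₂ true true W) +
      α₀ * (α₁ - α₂) * gateF (∑ W ∈ U.powerset, G W * cellWt m₁ m₂ false false W)
        (∑ W ∈ U.powerset, G W * cellWt m₁ m₂ false true W)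
        (∑ W ∈ U.powerset, G W * cellWt m₁ m₂ true false W)
        (∑ W ∈ U.powerset, G W * cellWt m₁ m₂ true true W)
        (∑ W ∈ U.powerset, T W * cellWt m₁ m₂ false false W)
        (∑ W ∈ U.powerset, T W * cellWt m₁ m₂ false true W)
        (∑ W ∈ U.powerset, T W * cellWt m₁ m₂ true false W)
        (∑ W ∈ U.powerset, T W * cellWt m₁ m₂ true true W) :=
    add_nonneg (mul_nonneg hα₂0 hFL)
      (mul_nonneg (mul_nonneg (hA0 _) (sub_nonneg.2 hα₂₁)) hFT)
  rw [← key] at hsum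
  -- conclude: either `α₁ > 0`, or `α₁ = 0` and then the gate is the `R`-law
  rcases hα₁0.eq_or_lt with hz | hpos
  · -- `α₁ = 0 ⟹ α₂ = 0`, `gValK = rValK` on the core
    have hz2 : α₂ = 0 := le_antisymm (hz ▸ hα₂₁) hα₂0
    have hgv : ∀ W ∈ U.powerset, ν W * gValK A pr ent c a w W = G W := by
      intro W hW
      simp only [hGdef]
      rw [hvW W (Finset.mem_powerset.1 hW), hgW W (Finset.mem_powerset.1 hW), ← hz, hz2]
    have hMG : ∀ b₁ b₂, (∑ W ∈ U.powerset, ν W * gValK A pr ent c a w W * cellWt m₁ m₂ b₁ b₂ W) =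
        ∑ W ∈ U.powerset, G W * cellWt m₁ m₂ b₁ b₂ W := fun b₁ b₂ =>
      Finset.sum_congr rfl fun W hW => by rw [hgv W hW]
    rw [hMG, hMG, hMG, hMG]
    unfold gateF at hFL
    simp only [hGdef] at hFL
    exact hFL
  · have := (mul_nonneg_iff_of_pos_left hpos).1 hsum
    unfold gateF at this
    simp only [hGdef] at this
    exact this
end TrivialHead

section TrivialHeadArcs

variable {V : Type*} {E : Type*} [DecidableEq V]
  {arcs : E → Finset (V × V)} {s : V} {U : Finset V} {a : V}

/-- A vertex whose out-arcs all land in `C` has no out-arc in the reduced map `coreOff arcs C`. -/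
lemma no_coreOff_arc_of_into' {C : Finset V} {v : V}
    (hout : ∀ e, ∀ xy ∈ arcs e, xy.1 = v → xy.2 ∈ C) {e : E} {y : V}
    (hy : (v, y) ∈ coreOff arcs C e) : False := by
  simp only [coreOff] at hy
  split_ifs at hy with hc
  · exact Finset.notMem_empty _ hy
  · apply hc
    refine ⟨(y, v), ?_, ?_⟩
    · exact mem_revArcs.2 hy
    · exact hout e (v, y) hy rfl

omit [DecidableEq V] in
/-- A vertex without out-arcs reaches only itself. -/
lemma reach_eq_of_no_out' {D : E → Finset (V × V)} {ω : Config E} {v t : V}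
    (hno : ∀ e, ∀ y, (v, y) ∈ D e → False) (h : Reach D ω v t) : v = t := by
  rcases Relation.ReflTransGen.cases_head h with rfl | ⟨y, hvy, _⟩
  · rfl
  · obtain ⟨e, _, hvy⟩ := hvy
    exact (hno e y hvy).elim

/-- **Entry-blindness from the arc structure.**  If every arc leaving a vertex of `U` lands in
`U ∪ {a}`, the avoidance event of `W ∪ X` is that of `X` (for `W ⊆ U`). -/
theorem coreAvoidEvent_trivial {t : V} (htC : t ∉ insert a U)
    (hout : ∀ v ∈ U, ∀ e, ∀ xy ∈ arcs e, xy.1 = v → xy.2 ∈ insert a U)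
    {W : Finset V} (hW : W ⊆ U) (X : Finset V) :
    coreAvoidEvent arcs s t (insert a U) (W ∪ X) = coreAvoidEvent arcs s t (insert a U) X := by
  ext ω
  simp only [coreAvoidEvent, Set.mem_setOf_eq]
  constructor
  · intro h v hv
    apply h v
    simp only [Finset.mem_insert, Finset.mem_union] at hv ⊢
    rcases hv with rfl | hvX
    · exact Or.inl rfl
    · exact Or.inr (Or.inr hvX)
  · intro h v hv hreach
    simp only [Finset.mem_insert, Finset.mem_union] at hv
    rcases hv with rfl | hvW | hvX
    · exact h v (Finset.mem_insert_self _ _) hreach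
    · have hvU : v ∈ U := hW hvW
      have hno : ∀ e, ∀ y, (v, y) ∈ coreOff arcs (insert a U) e → False :=
        fun e y hy => no_coreOff_arc_of_into' (hout v hvU) hy
      have := reach_eq_of_no_out' hno hreach
      subst this
      exact htC (Finset.mem_insert_of_mem hvU)
    · exact h v (Finset.mem_insert_of_mem hvX) hreach
end TrivialHeadArcs

section TrivialHeadMain

variable {V : Type*} {E : Type*} [Fintype V] [DecidableEq V] [Fintype E] [DecidableEq E]
  {R : Type*} [Field R] [LinearOrder R] [IsStrictOrderedRing R]
  {arcs : E → Finset (V × V)} {s : V} {U : Finset V} {ent : Finset V} {c : V → E} {a w : V}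

/-- **THEOREM (row 2′DARC at an OR-tail with ANY entry set when the core's only exits are the
tail).**  `OrTailK arcs s U ent c a` (any entries, any coins), `SameEnds`, the cluster law of `U`
log-supermodular, ANY two markers `m₁, m₂ ∈ U`, every arc leaving a vertex of `U` landing in
`U ∪ {a}`, `t, w ∉ U ∪ {a, s}` ⟹ `Φ_D({s ↛ t in D + (a → w)}) ≥ 0` for every head beyond `a, w`
and every probability vector. -/
theorem darc_of_orTailK_trivialHead (pr : E → R) (hp : IsProbVec pr) (hS : SameEnds arcs)
    (h : OrTailK arcs s U ent c a) {m₁ m₂ : V} (hm₁ : m₁ ∈ U) (hm₂ : m₂ ∈ U)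
    (hν : ∀ W W', W ⊆ U → W' ⊆ U →
      prob pr (coreLevel arcs s U W) * prob pr (coreLevel arcs s U W') ≤
        prob pr (coreLevel arcs s U (W ∩ W')) * prob pr (coreLevel arcs s U (W ∪ W')))
    {t : V} (htC : t ∉ insert a U) (hts : t ≠ s) (hws : w ≠ s) (hwC : w ∉ insert a U)
    (hout : ∀ v ∈ U, ∀ e, ∀ xy ∈ arcs e, xy.1 = v → xy.2 ∈ insert a U) :
    DARC pr arcs s {t} m₁ m₂ a w := by
  have hC := h.closedInCoreU
  have hm₁a : m₁ ≠ a := fun e => h.a_notin (e ▸ hm₁)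
  have hm₂a : m₂ ≠ a := fun e => h.a_notin (e ▸ hm₂)
  have hm₁C : m₁ ∈ insert a U := Finset.mem_insert_of_mem hm₁
  have hm₂C : m₂ ∈ insert a U := Finset.mem_insert_of_mem hm₂
  have haC : a ∈ insert a U := Finset.mem_insert_self _ _
  unfold DARC
  rw [hC.phiC_gate_eq pr hS htC hts hm₁C hm₂C haC hws hwC]
  have hm1 : ∀ W : Finset V, (fun _ : Finset V => (1 : R)) (insert a W) = (fun _ => (1 : R)) W :=
    fun _ => rfl
  have hmp : ∀ W : Finset V, (fun W : Finset V => if m₁ ∈ W then (1 : R) else 0) (insert a W) =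
      (fun W : Finset V => if m₁ ∈ W then (1 : R) else 0) W := by
    intro W; simp only [Finset.mem_insert, hm₁a, false_or]
  have hmq : ∀ W : Finset V, (fun W : Finset V => if m₂ ∈ W then (1 : R) else 0) (insert a W) =
      (fun W : Finset V => if m₂ ∈ W then (1 : R) else 0) W := by
    intro W; simp only [Finset.mem_insert, hm₂a, false_or]
  have hmpq : ∀ W : Finset V,
      (fun W : Finset V => (if m₁ ∈ W then (1 : R) else 0) * (if m₂ ∈ W then (1 : R) else 0))
        (insert a W) =
      (fun W : Finset V => (if m₁ ∈ W then (1 : R) else 0) * (if m₂ ∈ W then (1 : R) else 0)) W := by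
    intro W; simp only [Finset.mem_insert, hm₁a, hm₂a, false_or]
  have eΛ := h.sum_R_eq pr t (fun _ => (1 : R)) hm1
  have eFa := h.sum_R_eq pr t (fun W => if m₁ ∈ W then (1 : R) else 0) hmp
  have eFb := h.sum_R_eq pr t (fun W => if m₂ ∈ W then (1 : R) else 0) hmq
  have eM := h.sum_G_eq (w := w) pr t (fun _ => (1 : R)) hm1
  have eX := h.sum_G_eq (w := w) pr t (fun W => if m₁ ∈ W then (1 : R) else 0) hmp
  have eY := h.sum_G_eq (w := w) pr t (fun W => if m₂ ∈ W then (1 : R) else 0) hmq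
  have eXY := h.sum_G_eq (w := w) pr t
    (fun W => (if m₁ ∈ W then (1 : R) else 0) * (if m₂ ∈ W then (1 : R) else 0)) hmpq
  simp only [mul_one] at eΛ eM
  rw [eΛ, eFa, eFb, eM, eX, eY, eXY]
  obtain ⟨hA0, hAmono, hAlsm⟩ := OrTailU.head_props (U := U) (a := a) pr hp hS t
  exact orTailK_trivialHead_functional_nonneg U (fun W => prob pr (coreLevel arcs s U W))
    (fun X => prob pr (coreAvoidEvent arcs s t (insert a U) X)) pr ent c m₁ m₂ a w
    hp.nonneg hp.le_one (fun W => prob_nonneg hp _) (fun s' hs' t' ht' => hν s' t' hs' ht')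
    hA0 hAlsm hAmono (fun W hW X _ => by rw [coreAvoidEvent_trivial htC hout hW X])
end TrivialHeadMain
end Summit.Ventures.PercRepro2.Coin
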